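import Mathlib
import HarnessLib
import Summits.BirchSwinnertonDyer.BirchSwinnertonDyer.Theses.ManinLocalTwoThree
import Summits.BirchSwinnertonDyer.Rank1Residual.ManinAdditive.TwoNotDvdManinOfTwistAtTwoEdges
import Summits.BirchSwinnertonDyer.Rank1Residual.ManinAdditive.TwistOrbitDegreeIdentity
import Literature.NumberTheory.EllipticCurves.ModularCurveNonempty
import Literature.NumberTheory.EllipticCurves.IsogenyIdProofs

/-!
# Lines/dyadic-twist.lean — first REAL skeleton line of crux `ManinOddAtFour` (C2, stmt-22967)
(route `ManinLocalTwoThree`; planner bsd-f2-manin-imc g8, 2026-08-27; refines the BC3 birth skeleton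
`Lines/birth.lean` = {twist-covered, twist-minimal}).

IDEA (slug `dyadic-twist`). Partition the optimal classes with `4 ∣ N` by the DYADIC TWIST PREDICATE
«the class of `W` is a `d`-twist, `d ∈ {-1, 2, -2}`, of a class that is semistable at `2`»
(equivalently: semistability defect `e₂ ≤ 2`). On the twist-COVERED side the crux is now CLOSED modulo
ONE named beyond-print leaf and ONE local lemma:
* the tree theorem `not_dvd_maninConstant_of_isTwistOfSemistableAtTwo_etaOne_gamma0` (η = 1:
  `d = -1`, or `W′` multiplicative at `2`, or `a₂(W′)` odd) and the landed edge
  `twoNotDvdManinOfTwistOfSemistableAtTwo_of_etaTwo` (E-an-2 ⟸ E-an-1) reduce it to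
  `stub_etaTwo` = the tree leaf `TwoNotDvdManinOfTwistEtaTwo` BY NAME (E-an-1, the `η = 2` law:
  `d = ±2`, `W′` good at `2` with `a₂(W′)` even — no printed theorem; 7 042 classes `N ≤ 500 000`, `c₀ = 1` on all);
* `stub_dyadicTwistConductor` = the local conductor bookkeeping of a dyadic twist of a `2`-semistable
  curve (`f₂ = 2·a(χ_d) ∈ {4, 6}`, odd part unchanged): `N(W′) ∣ N(W)` and `(4|d|)² ∣ N(W)` — in the tree
  for `W′` good at `2` (`conductorNorm_quadraticTwist_neg_one / _two / _neg_two`), new for `W′`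
  multiplicative at `2` (Tate curve ⊗ ramified quadratic character: Swan conductor doubles).
The twist-MINIMAL side `stub_twistMinimalAtTwo` (verbatim the birth stub: potentially GOOD reduction at
`2` with `e₂ ∈ {3,4,6,8,24}`, all of `v₂(N) ∈ {2,3,5,7,8}` and the minimal classes at `v₂(N) ∈ {4,6}`)
is the hard core: no printed theorem and no cell mechanism yet (ČNS Thm 1.2 only gives
`v₂(c₀) ≤ v₂(deg φ) + ε₂`, and `deg φ` is even there generically — Calegari–Emerton).
`ManinOddAtFour_of` is the kernel-checked composition concluding the ROUTE DECL by name; the level is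
identified with the conductor by `ModularParametrizationData.level_eq_conductorNorm_of_exists` (modularity
is a hypothesis of the crux) and additivity at `2` by `not_good_and_not_mult_of_sq_dvd_conductorNorm`.
-/

set_option autoImplicit false
set_option linter.dupNamespace false

noncomputable section

open WeierstrassCurve Literature.NumberTheory.EllipticCurves
  Literature.NumberTheory.EllipticCurves.ModularForms
  Summit.BirchSwinnertonDyer.Rank1Residual.ManinAdditive

namespace Summit.BirchSwinnertonDyer.BirchSwinnertonDyer.Cruxes.ManinOddAtFour.DyadicTwist

/-- STUB 1 (`η = 2` LAW, the tree leaf E-an-1 BY NAME; size L; beyond print). For `W ~ W′ ⊗ χ_d`,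
`d = ±2`, `W′` minimal, GOOD at `2` with `a₂(W′)` even, `N(W′) ∣ N(W)`, `(4|d|)² ∣ N(W)`, `W` additive
at `2`: every lattice-optimal datum of a minimal curve of the class has odd Manin constant. -/
theorem stub_etaTwo : TwoNotDvdManinOfTwistEtaTwo := by
  sorry

/-- STUB 2 (DYADIC TWIST CONDUCTOR BOOKKEEPING; size M; local, true: `f₂(W′ ⊗ χ_d) = 2·a(χ_d)` for
`W′` semistable at `2` and `χ_d`, `d ∈ {-1, ±2}`, ramified only at `2`; modularity allowed as input since
the crux carries it). -/
theorem stub_dyadicTwistConductor :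
    exists_isNewformOf →
    ∀ {W : WeierstrassCurve ℚ} [W.IsElliptic] {W' : WeierstrassCurve ℚ} [W'.IsElliptic]
      [W'.IsGloballyMinimal] {d : ℤ}, (d = -1 ∨ d = 2 ∨ d = -2) →
      IsIsogenous W (W'.quadraticTwist (d : ℚ)) → ¬ 2 ^ 2 ∣ W'.conductorNorm ℤ →
      (¬ W.HasGoodReductionAtPrime 2 ∧ ¬ W.HasMultiplicativeReductionAtPrime 2) →
      W'.conductorNorm ℤ ∣ W.conductorNorm ℤ ∧ (4 * d.natAbs) ^ 2 ∣ W.conductorNorm ℤ := by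
  sorry

/-- STUB 3 (TWIST-MINIMAL CORE AT `2`; size XL; verbatim the birth stub `stub_twistMinimalAtTwo`). -/
theorem stub_twistMinimalAtTwo :
      mazur_not_dvd_maninConstant_of_odd →
      abbesUllmo_not_dvd_maninConstant_of_not_dvd_level →
      cesnavicius_not_two_dvd_maninConstant_of_two_dvd_level →
      exists_isNewformOf →
      ∀ (W : WeierstrassCurve ℚ) [W.IsElliptic] [W.IsGloballyMinimal] {N : ℕ} [NeZero N]
        (D : ModularParametrizationData W N),
        (∀ z ∈ D.L.lattice, ∃ w ∈ periodLattice D.f, z = D.c * w) → 2 ^ 2 ∣ N →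
        ¬ (∃ (W' : WeierstrassCurve ℚ) (d : ℤ), W'.IsElliptic ∧ W'.IsGloballyMinimal ∧
          (d = -1 ∨ d = 2 ∨ d = -2) ∧ IsIsogenous W (W'.quadraticTwist (d : ℚ)) ∧
          ¬ 2 ^ 2 ∣ W'.conductorNorm ℤ) →
        ¬ (2 : ℤ) ∣ D.maninConstant := by
  sorry

/-- COMPOSITION (no sorry): the three stubs give the crux BY NAME. The twist-covered half is proved
here from STUB 1 + STUB 2 + the tree's `η = 1` theorem (through the landed E-an-2 ⟸ E-an-1 edge). -/
theorem ManinOddAtFour_of :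
    Summit.BirchSwinnertonDyer.BirchSwinnertonDyer.Theses.ManinLocalTwoThree.ManinOddAtFour := by
  intro hM hAU hC hnf W _ _ N _ D hopt h4
  by_cases hex : (∃ (W' : WeierstrassCurve ℚ) (d : ℤ), W'.IsElliptic ∧ W'.IsGloballyMinimal ∧
      (d = -1 ∨ d = 2 ∨ d = -2) ∧ IsIsogenous W (W'.quadraticTwist (d : ℚ)) ∧
      ¬ 2 ^ 2 ∣ W'.conductorNorm ℤ)
  · -- twist-covered: level = conductor (modularity), additivity at 2, bookkeeping, then E-an-2.
    haveI : Fact (Nat.Prime 2) := ⟨Nat.prime_two⟩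
    have hN : N = W.conductorNorm ℤ :=
      ModularParametrizationData.level_eq_conductorNorm_of_exists hnf D
    have h4W : 2 ^ 2 ∣ W.conductorNorm ℤ := hN ▸ h4
    have hadd : ¬ W.HasGoodReductionAtPrime 2 ∧ ¬ W.HasMultiplicativeReductionAtPrime 2 :=
      not_good_and_not_mult_of_sq_dvd_conductorNorm W h4W
    obtain ⟨W', d, hW'e, hW'm, hd, htw, h4N'⟩ := hex
    haveI := hW'e
    haveI := hW'm
    obtain ⟨hN'N, hmN⟩ := stub_dyadicTwistConductor hnf hd htw h4N' hadd
    exact twoNotDvdManinOfTwistOfSemistableAtTwo_of_etaTwo stub_etaTwo hM hAU hC hnf hd htw hN'N hmN h4N'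
      hadd W D (IsIsogenous.refl_holds W) hopt
  · exact stub_twistMinimalAtTwo hM hAU hC hnf W D hopt h4 hex

end Summit.BirchSwinnertonDyer.BirchSwinnertonDyer.Cruxes.ManinOddAtFour.DyadicTwist

end
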